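import Summits.BirchSwinnertonDyer.BirchSwinnertonDyer.Theorems.ErratumRoadFiveShimuraKolyvaginOrderBoundInertShiftCebotarev
import Summits.BirchSwinnertonDyer.BirchSwinnertonDyer.Theorems.Rank1ResidualJetCebotarevAdapter
import Literature.NumberTheory.EllipticCurves.CasselsTateSelmerKolyvaginValue
import Literature.NumberTheory.EllipticCurves.HeegnerPointsKolyvaginPrimaryCongruenceProofs
import Literature.NumberTheory.EllipticCurves.IsogenyFrobeniusTraceProofs
import Literature.NumberTheory.EllipticCurves.NonvanishingTwistsWaldspurgerOfHoffsteinLuo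
import Literature.NumberTheory.Automorphic.ChebotarevArtinRepHolds
import Literature.NumberTheory.EllipticCurves.WeilPairingProofs
import HarnessLib

/-!
# Jetchev 2008 Lemma 6.1 DECOUPLED (level `p^k`, Kolyvagin primes of index `≥ k + j`) — the `h61`
# input of the kernel §6 WALK `JET.Section6.exists_halfCoreVertex` ∕ `tamagawaExponent_le_m_of_selmerFamilies`
# in the localisation currency, as a KERNEL THEOREM (cell `bsd-stepL`, seat `bsd-stepL-tam3-p1`,
# helper toward item 19109 `EulerHalvesAtThree`, registered stub `stub_jetchevMaxHLAtThree`)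

HONEST FRAMING. Nothing here proves BSD, J₃ or the divisibility of any Heegner point; the registered
stub `stub_jetchevMaxHLAtThree` is NOT discharged; no item closes; 0 classes move (T7);
`--supports stmt-BirchSwinnertonDyer-19109` (helper). WHAT THIS FILE DOES. The walk of [J] Prop. 6.4
(kernel `exists_halfCoreVertex`, p484455) moves from a conductor `c` with `m(c) < k` to `c·ℓ₁⋯ℓ_s`
through Kolyvagin primes `ℓ_i ∈ Λ¹` of index `M(ℓ_i) ≥ k + m(c)` (so that `κ̃_{cℓ,k}` exists at the
next conductor), chosen by Lemma 6.1 for classes of LEVEL `p^k`: the index bound and the level are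
DECOUPLED. The typed McCallum Cor. 3.2 (`McCallum1991.cor32_…`, consumed by p491014 and by bsd-jet's
p490622) couples them (`M` = level = index bound). Here the decoupled form is PROVED (no named fact):
`exists_kolyvaginPrime_addOrderOf_localization_eq_shift` — for `x ∈ H¹(K,E[p^k])^{e}`, `y ≠ 0` in
`H¹(K,E[p^k])^{−e}`, any `j` and any bound `b`, a Kolyvagin prime `ℓ > b` (Zhang's sense, for
`N = N_E`) of index `≥ k + j` at whose place `λ` the localisation preserves the orders of `x` and `y`
— from the KERNEL theorem `McCallum1991_cor_3_2_pow_shift_of_chebotarev` (shim seats, level shift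
`ι_* : H¹(K,E[p^k]) ↪ H¹(K,E[p^{k+j}])`, p-file `ErratumRoadFiveShimuraKolyvaginOrderBoundInertShiftCebotarev`)
fed with the PROVED Čebotarev theorem (`chebotarev_artinRep_holds`) and the Weil pairing
(`exists_weilPairing_holds`); plus the bridge `zhang_isKolyvaginPrime_of_frobEqFrobInfty` (Gross's
Kolyvagin prime with `Frob ℓ = Frob ∞` on `K(E[p^M])` ⟹ Zhang's Kolyvagin prime of index `≥ M`, via
`a_ℓ ≡ ℓ + 1 ≡ 0 mod p^M`). Inputs on `E`: `K` imaginary quadratic, `p` odd, `ρ̄_{E,p}` onto — NO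
tower hypothesis, no CM clause (weaker than the typed fact's binders).
References (locators only; no cited FACT declared): [cite: Jetchev2008, Lemma 5.1 (p. 821) = arXiv Lemma 6.1]
[cite: McCallumLMS1991, §3 Cor. 3.2 (p. 299), §4 Lemma 4.6] [cite: GrossLMS1991, §3 (3.1)–(3.3)]
[cite: WZhang2014, Notations (xii)]. Design: theorems only; `K : Type`. Axioms: `propext`,
`Classical.choice`, `Quot.sound`.
-/

set_option autoImplicit false

noncomputable section

open scoped Classical NumberField

namespace Summit.BirchSwinnertonDyer.Rank1Residual.X11b.Three.Koly

open WeierstrassCurve IsDedekindDomain NumberField Literature.NumberTheory.EllipticCurves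
  Literature.NumberTheory.EllipticCurves.ModularForms Literature.NumberTheory.GaloisRepresentations
  Summit.BirchSwinnertonDyer.BirchSwinnertonDyer.Theorems

variable (W : WeierstrassCurve ℚ) [W.IsElliptic] [W.IsGloballyMinimal] [NeZero (W.conductorNorm ℤ)]
  {K : Type} [Field K] [NumberField K]

omit [NeZero (W.conductorNorm ℤ)] in
/-- **Bridge: Gross's Kolyvagin prime with `Frob(ℓ) = Frob(∞)` on `K(E[p^M])` is a Kolyvagin prime
in Zhang's sense of index `M(ℓ) ≥ M`** (for the conductor `N = N_E`): the congruences
`p^M ∣ ℓ + 1` (`pow_dvd_add_one_of_frobEqFrobInfty`) and `p^M ∣ a_ℓ`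
(`pow_dvd_frobeniusTraceAt_of_frobEqFrobInfty` at the place of `ℚ` over `ℓ`, good reduction from
`ℓ ∤ N_E`, and `a_v = a_ℓ` for the globally minimal `W`), read through `Zhang2014.le_kolyvaginIndex_iff`.
[cite: GrossLMS1991, §3 (3.2)–(3.3)] [cite: WZhang2014, Notations (xii)] -/
theorem zhang_isKolyvaginPrime_of_frobEqFrobInfty {p : ℕ} (hp : p.Prime) {M : ℕ} (hM : 1 ≤ M)
    {ℓ : ℕ} (hℓ : IsKolyvaginPrime (W.conductorNorm ℤ) W K p ℓ)
    (hfrob : FrobEqFrobInfty W K (p ^ M) ℓ) :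
    Zhang2014.IsKolyvaginPrime (W.conductorNorm ℤ) W K p ℓ ∧ M ≤ Zhang2014.kolyvaginIndex W p ℓ := by
  haveI : Fact p.Prime := ⟨hp⟩
  obtain ⟨hℓP, hℓN, hℓD, hℓp, hprime, -⟩ := hℓ
  -- the place of `ℚ` over `ℓ`
  set v : HeightOneSpectrum (𝓞 ℚ) := (Rat.HeightOneSpectrum.primesEquiv (R := 𝓞 ℚ)).symm ⟨ℓ, hℓP⟩
    with hv
  have hℓv : (ℓ : 𝓞 ℚ) ∈ v.asIdeal := (natCast_mem_asIdeal_iff_eq_primesEquiv_symm v hℓP).mpr hv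
  have hpe : (Rat.HeightOneSpectrum.primesEquiv (R := 𝓞 ℚ) v : ℕ) = ℓ := by
    rw [hv, Equiv.apply_symm_apply]
  have hgood : W.HasGoodReductionAt v :=
    hasGoodReductionAt_of_not_dvd_conductorNorm W v (by rw [hpe]; exact hℓN)
  have h1 : p ^ M ∣ ℓ + 1 := pow_dvd_add_one_of_frobEqFrobInfty W (K := K) hp hM hℓP hℓp hfrob
  have h2 : ((p : ℤ) ^ M) ∣ W.frobeniusTrace ℓ := by
    have h := pow_dvd_frobeniusTraceAt_of_frobEqFrobInfty W (K := K) hp hM hℓP hℓp hfrob hℓv hgood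
    rwa [frobeniusTraceAt_eq_frobeniusTrace W v, hpe] at h
  have hidx : M ≤ Zhang2014.kolyvaginIndex W p ℓ :=
    Zhang2014.le_kolyvaginIndex_iff.mpr ⟨h1, by exact_mod_cast h2⟩
  exact ⟨⟨hℓP, hℓN, hℓD, hℓp, hprime, lt_of_lt_of_le (by omega) hidx⟩, hidx⟩

/-- **[J] Lemma 6.1 DECOUPLED — level `p^k`, index `≥ k + j` — in the localisation currency of the
kernel walk's `h61`.** For `W/ℚ` (globally minimal), `K` imaginary quadratic, `p` odd with `ρ̄_{E,p}`
onto, complex conjugation `τ ≠ 1`, a level `p^k` (`k ≥ 1`), an extra depth `j`, a class `x` with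
`τx = e • x` and a NON-ZERO class `y` with `τy = −e • y` (`e = ±1`) in `H¹(K, E[p^k])`, and any bound
`b`: there is a Kolyvagin prime `ℓ > b` (`Zhang2014.IsKolyvaginPrime` for `N = N_E`) of index
`M(ℓ) ≥ k + j` such that the localisation at the place `λ` of `K` above `ℓ` PRESERVES the orders of
`x` and `y`. PROOF: `McCallum1991_cor_3_2_pow_shift_of_chebotarev` (kernel; level shift along
`ι_* : H¹(K,E[p^k]) ↪ H¹(K,E[p^{k+j}])`) with `chebotarev_artinRep_holds` and `exists_weilPairing_holds`,
applied to the independent system `(x, y)` (resp. `(y)` if `x = 0`; independence of opposite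
eigenclasses `JET.dvd_of_zsmul_add_zsmul_eq_zero_of_eigen`), the dictionary
`torsionLocalKer = ker loc_λ` (`mem_torsionLocalKer_iff_res_eq_zero`), and the bridge above.
[cite: Jetchev2008, Lemma 5.1 (p. 821)] [cite: McCallumLMS1991, §3 Cor. 3.2 (p. 299), §4 Lemma 4.6] -/
theorem exists_kolyvaginPrime_addOrderOf_localization_eq_shift
    (hK : IsImaginaryQuadratic K) {p : ℕ} [Fact p.Prime] (hp2 : p ≠ 2)
    (hρ : W.HasSurjectiveModNGaloisRep p) (τ : K ≃ₐ[ℚ] K) (hτ : τ ≠ 1) {k : ℕ} (hk : 1 ≤ k) (j : ℕ)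
    {e : ℤ} (he : e = 1 ∨ e = -1)
    (x y : galH1Torsion (W.baseChange K) ((p ^ k : ℕ) : ℤ))
    (hx : conjAct W τ ((p ^ k : ℕ) : ℤ) x = e • x) (hy : conjAct W τ ((p ^ k : ℕ) : ℤ) y = (-e) • y)
    (hy0 : y ≠ 0) (b : ℕ) :
    ∃ ℓ : ℕ, b < ℓ ∧ Zhang2014.IsKolyvaginPrime (W.conductorNorm ℤ) W K p ℓ ∧
      k + j ≤ Zhang2014.kolyvaginIndex W p ℓ ∧
      ∀ v : HeightOneSpectrum (𝓞 K), (ℓ : 𝓞 K) ∈ v.asIdeal →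
        addOrderOf (galoisCohomology.localization
            ((W.baseChange K).torsionGaloisModule ((p ^ k : ℕ) : ℤ)) (Sum.inr v) 1 x) = addOrderOf x ∧
        addOrderOf (galoisCohomology.localization
            ((W.baseChange K).torsionGaloisModule ((p ^ k : ℕ) : ℤ)) (Sum.inr v) 1 y) = addOrderOf y := by
  have hp : p.Prime := Fact.out
  -- every class is killed by `p^k`, so orders are powers of `p` (and prime to `2`)
  have hkill : ∀ z : galH1Torsion (W.baseChange K) ((p ^ k : ℕ) : ℤ), p ^ k • z = 0 := fun z ↦
    galoisCohomology.nsmul_eq_zero_of_forall ((W.baseChange K).torsionGaloisModule ((p ^ k : ℕ) : ℤ))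
      (fun T ↦ by
        have h := (W.baseChange K).natAbs_nsmul_geomTorsion T
        rwa [Int.natAbs_natCast] at h) z
  have hordpow : ∀ z : galH1Torsion (W.baseChange K) ((p ^ k : ℕ) : ℤ), ∃ a ≤ k, addOrderOf z = p ^ a :=
    fun z ↦ (Nat.dvd_prime_pow hp).mp (addOrderOf_dvd_of_nsmul_eq_zero (hkill z))
  have hcop2 : ∀ z : galH1Torsion (W.baseChange K) ((p ^ k : ℕ) : ℤ), (addOrderOf z).Coprime 2 := by
    intro z
    obtain ⟨a, -, ha⟩ := hordpow z
    rw [ha]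
    exact Nat.Coprime.pow_left _ ((Nat.coprime_primes hp Nat.prime_two).mpr hp2)
  -- the localisation at the place `v`, typed on `galH1Torsion` (= `galoisCohomology _ 1` by `rfl`)
  let loc : ∀ v : HeightOneSpectrum (𝓞 K), galH1Torsion (W.baseChange K) ((p ^ k : ℕ) : ℤ) →+
      galoisCohomology (((W.baseChange K).torsionGaloisModule ((p ^ k : ℕ) : ℤ)).toLocal (Sum.inr v)) 1 :=
    fun v ↦ galoisCohomology.localization ((W.baseChange K).torsionGaloisModule ((p ^ k : ℕ) : ℤ))
      (Sum.inr v) 1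
  -- dictionary: multiples in `torsionLocalKer` = multiples killed by the localisation
  have hloc : ∀ (v : HeightOneSpectrum (𝓞 K)) (z : galH1Torsion (W.baseChange K) ((p ^ k : ℕ) : ℤ))
      (a : ℕ), loc v (p ^ a • z) = 0 ↔
        ((p : ℤ) ^ a) • z ∈ (W.baseChange K).torsionLocalKer (v.adicCompletion K) ((p ^ k : ℕ) : ℤ) := by
    intro v z a
    haveI : CharZero (v.adicCompletion K) := charZero_of_injective_algebraMap (algebraMap K _).injective
    have hz : ((p : ℤ) ^ a) • z = p ^ a • z := by
      rw [← natCast_zsmul]; push_cast; rfl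
    rw [hz, mem_torsionLocalKer_iff_res_eq_zero (W := W.baseChange K)
      (E := v.adicCompletion K) (pow_ne_zero k hp.ne_zero)]
    exact Iff.rfl
  -- from «`p^a z ∈ ker`, `p^{a-1} z ∉ ker`» to `addOrderOf (loc z) = p^a = addOrderOf z`
  have hconv : ∀ (v : HeightOneSpectrum (𝓞 K)) (z : galH1Torsion (W.baseChange K) ((p ^ k : ℕ) : ℤ))
      (a : ℕ), addOrderOf z = p ^ a →
      (((p : ℤ) ^ a) • z ∈ (W.baseChange K).torsionLocalKer (v.adicCompletion K) ((p ^ k : ℕ) : ℤ) ∧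
        (a ≠ 0 → ((p : ℤ) ^ (a - 1)) • z ∉
          (W.baseChange K).torsionLocalKer (v.adicCompletion K) ((p ^ k : ℕ) : ℤ))) →
      addOrderOf (loc v z) = addOrderOf z := by
    intro v z a ha ⟨h1, h2⟩
    rw [ha]
    rcases Nat.eq_zero_or_pos a with rfl | hapos
    · -- `z = 0`
      have hz : z = 0 := by rw [← AddMonoid.addOrderOf_eq_one_iff, ha, pow_zero]
      rw [hz, map_zero, addOrderOf_zero, pow_zero]
    · obtain ⟨a', rfl⟩ : ∃ a', a = a' + 1 := ⟨a - 1, by omega⟩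
      have hfin : p ^ (a' + 1) • loc v z = 0 := by rw [← map_nsmul]; exact (hloc v z _).mpr h1
      have hnot : ¬ p ^ a' • loc v z = 0 := by
        intro h0
        rw [← map_nsmul] at h0
        exact h2 (by omega) (by simpa using (hloc v z a').mp h0)
      exact addOrderOf_eq_prime_pow hnot hfin
  obtain ⟨b', -, hb'⟩ := hordpow y
  have hey : (-e = 1 ∨ -e = -1) := by rcases he with rfl | rfl <;> norm_num
  -- the non-vanishing clause `hN` from the order
  have hNof : ∀ (z : galH1Torsion (W.baseChange K) ((p ^ k : ℕ) : ℤ)) (a : ℕ), addOrderOf z = p ^ a →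
      a ≠ 0 → ((p : ℤ) ^ (a - 1)) • z ≠ 0 := by
    intro z a ha ha0 h0
    have hz : ((p : ℤ) ^ (a - 1)) • z = p ^ (a - 1) • z := by
      rw [← natCast_zsmul]; push_cast; rfl
    rw [hz] at h0
    have hlt : p ^ (a - 1) < addOrderOf z := by
      rw [ha]; exact Nat.pow_lt_pow_right hp.one_lt (by omega)
    exact (nsmul_ne_zero_of_lt_addOrderOf (pow_ne_zero _ hp.ne_zero) hlt) h0
  by_cases hx0 : x = 0
  · -- the system `(y)`
    obtain ⟨ℓ, hbℓ, hKol, hfrob, hordloc⟩ :=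
      McCallum1991_cor_3_2_pow_shift_of_chebotarev (N := W.conductorNorm ℤ) (W := W)
        Literature.NumberTheory.Automorphic.chebotarev_artinRep_holds hK hp hp2 hρ
        (exists_weilPairing_holds W p) hk j hτ ![y]
        (by intro i; fin_cases i; exact hy0) ![b']
        (by intro i hi; fin_cases i; exact hNof y b' hb' hi)
        (by intro i; fin_cases i; exact ⟨-e, hey, hy⟩)
        (by
          intro a ha i
          fin_cases i
          simpa using ha)
        b
    obtain ⟨hZ, hidx⟩ := zhang_isKolyvaginPrime_of_frobEqFrobInfty W hp (by omega) hKol hfrob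
    refine ⟨ℓ, hbℓ, hZ, hidx, fun v hv ↦ ⟨?_, ?_⟩⟩
    · show addOrderOf (loc v x) = addOrderOf x
      rw [hx0, map_zero, addOrderOf_zero, addOrderOf_zero]
    · exact hconv v y b' hb' (by simpa using hordloc 0 v hv)
  · -- the system `(x, y)`
    obtain ⟨a', -, ha'⟩ := hordpow x
    obtain ⟨ℓ, hbℓ, hKol, hfrob, hordloc⟩ :=
      McCallum1991_cor_3_2_pow_shift_of_chebotarev (N := W.conductorNorm ℤ) (W := W)
        Literature.NumberTheory.Automorphic.chebotarev_artinRep_holds hK hp hp2 hρ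
        (exists_weilPairing_holds W p) hk j hτ ![x, y]
        (by
          intro i
          fin_cases i
          · exact hx0
          · exact hy0)
        ![a', b']
        (by
          intro i hi
          fin_cases i
          · exact hNof x a' ha' hi
          · exact hNof y b' hb' hi)
        (by
          intro i
          fin_cases i
          · exact ⟨e, he, hx⟩
          · exact ⟨-e, hey, hy⟩)
        (by
          intro c hc i
          have hc' : c 0 • x + c 1 • y = 0 := by simpa [Fin.sum_univ_two] using hc
          obtain ⟨h0, h1⟩ := JET.dvd_of_zsmul_add_zsmul_eq_zero_of_eigen
            (conjAct W τ ((p ^ k : ℕ) : ℤ)) he hx hy (hcop2 x) (hcop2 y) hc'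
          fin_cases i
          · simpa using addOrderOf_dvd_iff_zsmul_eq_zero.mp h0
          · simpa using addOrderOf_dvd_iff_zsmul_eq_zero.mp h1)
        b
    obtain ⟨hZ, hidx⟩ := zhang_isKolyvaginPrime_of_frobEqFrobInfty W hp (by omega) hKol hfrob
    refine ⟨ℓ, hbℓ, hZ, hidx, fun v hv ↦ ⟨?_, ?_⟩⟩
    · exact hconv v x a' ha' (by simpa using hordloc 0 v hv)
    · exact hconv v y b' hb' (by simpa using hordloc 1 v hv)

end Summit.BirchSwinnertonDyer.Rank1Residual.X11b.Three.Koly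

end
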